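import Literature.MathematicalPhysics.QuantumLattice.WilsonFermionGramKernel
import HarnessLib

/-!
# Regularity and locality of the fermionic Gram data

Continuity, measurability and boundedness (in the gauge field `U ∈ SU(N)^{edges}`, a compact
metrisable space) of the fermionic features `Φ_q(U)` and coupling `Q̂(U)` of
`WilsonFermionGramKernel` for `m > -1`, and their locality: `Q̂(U)` depends only on the spatial
links inside the reflection planes `t = 0`, `t = T`, and `Φ_q(U)` only on the links with both
endpoints in `0 ≤ t ≤ T` that are not inside the plane `t = 0` (the blocks `M₀`, `P₀` of
`TorusSiteRP`). These are the hypotheses of the abstract site-reflection mechanism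
`LatticeRP.integral_sum_coupling_nonneg`. [folklore]
-/

noncomputable section

-- The time-slice index types (`((κ × Fin 2) ⊕ (κ × Fin 2)) × Fin (n+1)` and the Gram indices built
-- from them) are too deep for the default instance-search size bound (`DecidableEq`, needed by
-- `Matrix.det`).
set_option synthInstance.maxSize 512

namespace Literature.MathematicalPhysics.QuantumLattice

section FermionGramRegularity

open _root_.Matrix Literature.Probability.LatticeModels QuantumFieldTheory Literature.LinearAlgebra.Matrix
open _root_.MeasureTheory
open scoped Kronecker ComplexOrder

variable {h N : ℕ}

local notation "𝕊𝕌" => Matrix.specialUnitaryGroup (Fin N) ℂ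
local notation "𝕌" => Matrix.unitaryGroup (Fin N) ℂ
local notation "ρ₀" => unitaryFundamentalRep (Fin N) ℂ

/-! ### Continuity of the slice data -/

/-- The matrix of an antiperiodically lifted link depends continuously on the gauge field. [folklore] -/
theorem continuous_coe_apLift (e : Edge 4 (h + 1 + (h + 1))) :
    Continuous fun U : GaugeConfig 4 (h + 1 + (h + 1)) 𝕊𝕌 => ((apLift U e : 𝕌) : Matrix (Fin N) (Fin N) ℂ) := by
  simp only [coe_apLift_apply]
  split_ifs
  · exact (continuous_subtype_val.comp (continuous_apply e)).neg
  · exact continuous_subtype_val.comp (continuous_apply e)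

/-- The inverse matrix of an antiperiodically lifted link depends continuously on the gauge field. [folklore] -/
theorem continuous_coe_apLift_inv (e : Edge 4 (h + 1 + (h + 1))) :
    Continuous fun U : GaugeConfig 4 (h + 1 + (h + 1)) 𝕊𝕌 => (((apLift U e)⁻¹ : 𝕌) : Matrix (Fin N) (Fin N) ℂ) := by
  have : ∀ U : GaugeConfig 4 (h + 1 + (h + 1)) 𝕊𝕌, (((apLift U e)⁻¹ : 𝕌) : Matrix (Fin N) (Fin N) ℂ) =
      (((apLift U e : 𝕌) : Matrix (Fin N) (Fin N) ℂ))ᴴ := fun U => by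
    rw [← Unitary.star_eq_inv, Unitary.coe_star, Matrix.star_eq_conjTranspose]
  simp only [this]
  exact (continuous_coe_apLift e).matrix_conjTranspose

/-- The matrix of a link depends continuously on the gauge field. [folklore] -/
theorem continuous_coe_unitaryLift (e : Edge 4 (h + 1 + (h + 1))) :
    Continuous fun U : GaugeConfig 4 (h + 1 + (h + 1)) 𝕊𝕌 => ((unitaryLift U e : 𝕌) : Matrix (Fin N) (Fin N) ℂ) := by
  simp only [coe_unitaryLift_apply]
  exact continuous_subtype_val.comp (continuous_apply e)

/-- A function which is one of two continuous functions according to a fixed condition is continuous. [folklore] -/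
private theorem continuous_ite_const {X Y : Type*} [TopologicalSpace X] [TopologicalSpace Y] (p : Prop) [Decidable p]
    {f g : X → Y} (hf : Continuous f) (hg : Continuous g) : Continuous fun x => if p then f x else g x := by
  by_cases hp : p <;> simp only [hp, ↓reduceIte] <;> assumption

/-- `U ↦ a_t[U]` is continuous. [folklore] -/
theorem continuous_apDiag (m : ℝ) (t : Fin (h + 1 + (h + 1))) :
    Continuous fun U : GaugeConfig 4 (h + 1 + (h + 1)) 𝕊𝕌 => apDiag U m t := by
  refine continuous_matrix fun p q => ?_
  obtain ⟨⟨y, a⟩, k⟩ := p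
  obtain ⟨⟨y', b⟩, k'⟩ := q
  simp only [apDiag, sliceDiag_apply, unitaryFundamentalRep_apply]
  refine continuous_const.sub (continuous_const.mul (continuous_finsetSum _ fun j _ => ?_))
  exact ((continuous_ite_const _ (((continuous_coe_apLift _).matrix_elem a b)) continuous_const).add
    (continuous_ite_const _ (((continuous_coe_apLift_inv _).matrix_elem a b)) continuous_const)).mul continuous_const

/-- `U ↦ b_t[U]` is continuous. [folklore] -/
theorem continuous_apOff (t : Fin (h + 1 + (h + 1))) :
    Continuous fun U : GaugeConfig 4 (h + 1 + (h + 1)) 𝕊𝕌 => apOff U t := by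
  refine continuous_matrix fun p q => ?_
  obtain ⟨⟨y, a⟩, k⟩ := p
  obtain ⟨⟨y', b⟩, k'⟩ := q
  simp only [apOff, sliceOff_apply, unitaryFundamentalRep_apply]
  refine continuous_const.mul (continuous_finsetSum _ fun j _ => ?_)
  exact ((continuous_ite_const _ (((continuous_coe_apLift _).matrix_elem a b)) continuous_const).sub
    (continuous_ite_const _ (((continuous_coe_apLift_inv _).matrix_elem a b)) continuous_const)).mul continuous_const

/-- `U ↦ w_t[U]` is continuous. [folklore] -/
theorem continuous_apLink (t : Fin (h + 1 + (h + 1))) :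
    Continuous fun U : GaugeConfig 4 (h + 1 + (h + 1)) 𝕊𝕌 => apLink U t := by
  refine continuous_matrix fun p q => ?_
  obtain ⟨⟨y, a⟩, k⟩ := p
  obtain ⟨⟨y', b⟩, k'⟩ := q
  simp only [apLink, sliceLink_apply, unitaryFundamentalRep_apply]
  exact (continuous_ite_const _ ((continuous_coe_unitaryLift _).matrix_elem a b) continuous_const).mul continuous_const

variable [NeZero N]

/-- `U ↦ a_t[U]⁻¹` is continuous (`m > -1`). [folklore] -/
theorem continuous_apDiag_inv {m : ℝ} (hm : -1 < m) (t : Fin (h + 1 + (h + 1))) :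
    Continuous fun U : GaugeConfig 4 (h + 1 + (h + 1)) 𝕊𝕌 => (apDiag U m t)⁻¹ := by
  have heq : ∀ U : GaugeConfig 4 (h + 1 + (h + 1)) 𝕊𝕌, (apDiag U m t)⁻¹ =
      ((apDiag U m t).det)⁻¹ • (apDiag U m t).adjugate := fun U => by
    rw [Matrix.inv_def, Ring.inverse_eq_inv']
  simp only [heq]
  exact ((continuous_apDiag m t).matrix_det.inv₀ fun U => (det_apDiag_pos U hm t).ne').smul
    (continuous_apDiag m t).matrix_adjugate

/-- `U ↦ 𝒴_t[U]` is continuous (`m > -1`). [folklore] -/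
theorem continuous_apStep {m : ℝ} (hm : -1 < m) (t : Fin (h + 1 + (h + 1))) :
    Continuous fun U : GaugeConfig 4 (h + 1 + (h + 1)) 𝕊𝕌 => apStep U m t := by
  unfold apStep transferStep
  have ha := continuous_apDiag (N := N) (h := h) m t
  have hai := continuous_apDiag_inv (N := N) (h := h) hm t
  have hb := continuous_apOff (N := N) (h := h) t
  exact Continuous.matrix_fromBlocks hai (hai.matrix_mul hb).neg (hb.matrix_conjTranspose.matrix_mul hai).neg
    (((hb.matrix_conjTranspose.matrix_mul hai).matrix_mul hb).add ha)

/-- `U ↦ 𝔓[U]` is continuous (`m > -1`). [folklore] -/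
theorem continuous_posTransfer {m : ℝ} (hm : -1 < m) :
    Continuous fun U : GaugeConfig 4 (h + 1 + (h + 1)) 𝕊𝕌 => posTransfer U m := by
  unfold posTransfer halfTransfer
  simp only [List.ofFn_eq_map, ← List.map_reverse]
  refine continuous_list_prod _ fun s _ => ?_
  have hw : Continuous fun U : GaugeConfig 4 (h + 1 + (h + 1)) 𝕊𝕌 =>
      linkBlock (apLink U (Fin.castLE (Nat.le_add_right (h + 1) (h + 1)) s)) := by
    unfold linkBlock
    exact Continuous.matrix_fromBlocks (continuous_apLink _) continuous_const continuous_const (continuous_apLink _)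
  exact hw.matrix_conjTranspose.matrix_mul (continuous_ite_const _ continuous_const (continuous_apStep hm _))

/-- The stacked matrix `[1; 𝔓[U]]` depends continuously on `U`. [folklore] -/
theorem continuous_fromRows_posTransfer {m : ℝ} (hm : -1 < m) :
    Continuous fun U : GaugeConfig 4 (h + 1 + (h + 1)) 𝕊𝕌 =>
      Matrix.fromRows (1 : Matrix (SpinorIdx h N) (SpinorIdx h N) ℂ) (posTransfer U m) := by
  refine continuous_matrix fun p q => ?_
  rcases p with p | p
  · simp only [Matrix.fromRows_apply_inl]
    exact continuous_const
  · simp only [Matrix.fromRows_apply_inr]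
    exact (continuous_posTransfer hm).matrix_elem p q

omit [NeZero N] in
/-- `U ↦ c(U)` is continuous. [folklore] -/
theorem continuous_posDiagDet (m : ℝ) :
    Continuous fun U : GaugeConfig 4 (h + 1 + (h + 1)) 𝕊𝕌 => posDiagDet U m :=
  continuous_finsetProd _ fun _ _ => (continuous_apDiag m _).matrix_det

/-- **The fermionic feature depends continuously on the gauge field** (`m > -1`). [folklore] -/
theorem continuous_fermionFeature {m : ℝ} (hm : -1 < m) (q : GramIdx h N) :
    Continuous fun U : GaugeConfig 4 (h + 1 + (h + 1)) 𝕊𝕌 => fermionFeature U m q := by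
  unfold fermionFeature gramFeature
  exact (continuous_posDiagDet m).mul ((continuous_fromRows_posTransfer hm).matrix_submatrix q id).matrix_det

/-- **The fermionic coupling depends continuously on the gauge field** (`m > -1`). [folklore] -/
theorem continuous_fermionCoupling {m : ℝ} (hm : -1 < m) :
    Continuous fun U : GaugeConfig 4 (h + 1 + (h + 1)) 𝕊𝕌 => fermionCoupling U m := by
  unfold fermionCoupling gramCoupling
  refine ((continuous_apDiag m _).matrix_det.mul (continuous_apDiag m _).matrix_det).smul ?_
  refine continuous_matrix fun q' q => ?_
  simp only [Matrix.of_apply]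
  refine ((continuous_apStep hm _).matrix_det.mul continuous_const).mul ?_
  have hinv : Continuous fun U : GaugeConfig 4 (h + 1 + (h + 1)) 𝕊𝕌 => (apStep U m 0)⁻¹ := by
    have heq : ∀ U : GaugeConfig 4 (h + 1 + (h + 1)) 𝕊𝕌, (apStep U m 0)⁻¹ =
        ((apStep U m 0).det)⁻¹ • (apStep U m 0).adjugate := fun U => by
      rw [Matrix.inv_def, Ring.inverse_eq_inv']
    simp only [heq]
    exact ((continuous_apStep hm 0).matrix_det.inv₀ fun U => (posDef_apStep U hm 0).det_pos.ne').smul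
      (continuous_apStep hm 0).matrix_adjugate
  exact ((Continuous.matrix_fromBlocks hinv continuous_const continuous_const (continuous_apStep hm _)).matrix_submatrix
    q q').matrix_det

/-! ### Measurability and bounds -/

omit [NeZero N] in
/-- `SU(N)` is second countable (a subspace of `ℂ^{N×N}`). [folklore] -/
theorem secondCountableTopology_specialUnitaryGroup : SecondCountableTopology 𝕊𝕌 := by
  haveI : SecondCountableTopology (Matrix (Fin N) (Fin N) ℂ) :=
    inferInstanceAs (SecondCountableTopology (Fin N → Fin N → ℂ))
  exact TopologicalSpace.Subtype.secondCountableTopology _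

attribute [local instance] secondCountableTopology_specialUnitaryGroup

omit [NeZero N] in
/-- The configuration space of `SU(N)` gauge fields carries the Borel structure of its (compact
metrisable) product topology, so continuous functions of the gauge field are measurable. [folklore] -/
theorem opensMeasurableSpace_gaugeConfig :
    OpensMeasurableSpace (GaugeConfig 4 (h + 1 + (h + 1)) 𝕊𝕌) :=
  Pi.opensMeasurableSpace

attribute [local instance] opensMeasurableSpace_gaugeConfig

/-- The fermionic feature is measurable. [folklore] -/
theorem measurable_fermionFeature {m : ℝ} (hm : -1 < m) (q : GramIdx h N) :
    Measurable fun U : GaugeConfig 4 (h + 1 + (h + 1)) 𝕊𝕌 => fermionFeature U m q :=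
  (continuous_fermionFeature hm q).measurable

/-- The entries of the fermionic coupling are measurable. [folklore] -/
theorem measurable_fermionCoupling_apply {m : ℝ} (hm : -1 < m) (q' q : GramIdx h N) :
    Measurable fun U : GaugeConfig 4 (h + 1 + (h + 1)) 𝕊𝕌 => fermionCoupling U m q' q :=
  ((continuous_fermionCoupling hm).matrix_elem q' q).measurable

/-- The fermionic feature is bounded (compactness of the configuration space). [folklore] -/
theorem exists_bound_fermionFeature {m : ℝ} (hm : -1 < m) :
    ∃ C : ℝ, ∀ (q : GramIdx h N) (U : GaugeConfig 4 (h + 1 + (h + 1)) 𝕊𝕌), ‖fermionFeature U m q‖ ≤ C := by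
  have hq : ∀ q : GramIdx h N, ∃ C : ℝ, ∀ U : GaugeConfig 4 (h + 1 + (h + 1)) 𝕊𝕌, ‖fermionFeature U m q‖ ≤ C :=
    fun q => by
      obtain ⟨C, hC⟩ := isCompact_univ.exists_bound_of_continuousOn (continuous_fermionFeature hm q).continuousOn
      exact ⟨C, fun U => hC U (Set.mem_univ U)⟩
  choose C hC using hq
  exact ⟨∑ q, |C q|, fun q U => (hC q U).trans ((le_abs_self _).trans
    (Finset.single_le_sum (fun q _ => abs_nonneg (C q)) (Finset.mem_univ q)))⟩

/-- The fermionic coupling is bounded. [folklore] -/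
theorem exists_bound_fermionCoupling {m : ℝ} (hm : -1 < m) :
    ∃ C : ℝ, ∀ (U : GaugeConfig 4 (h + 1 + (h + 1)) 𝕊𝕌) (q' q : GramIdx h N), ‖fermionCoupling U m q' q‖ ≤ C := by
  have hq : ∀ q' q : GramIdx h N, ∃ C : ℝ, ∀ U : GaugeConfig 4 (h + 1 + (h + 1)) 𝕊𝕌, ‖fermionCoupling U m q' q‖ ≤ C :=
    fun q' q => by
      obtain ⟨C, hC⟩ := isCompact_univ.exists_bound_of_continuousOn
        ((continuous_fermionCoupling hm).matrix_elem q' q).continuousOn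
      exact ⟨C, fun U => hC U (Set.mem_univ U)⟩
  choose C hC using hq
  refine ⟨∑ q', ∑ q, |C q' q|, fun U q' q => (hC q' q U).trans ((le_abs_self _).trans ?_)⟩
  exact (Finset.single_le_sum (fun q _ => abs_nonneg (C q' q)) (Finset.mem_univ q)).trans
    (Finset.single_le_sum (fun q' _ => Finset.sum_nonneg fun q _ => abs_nonneg (C q' q)) (Finset.mem_univ q'))

/-! ### Locality: which links the Gram data depend on -/

omit [NeZero N] in
/-- The time coordinate of a slice site. [folklore] -/
theorem val_sliceSite_zero (t : Fin (h + 1 + (h + 1))) (y : Fin 3 → ZMod (h + 1 + (h + 1))) :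
    ((sliceSite t y) 0).val = t.val := by
  rw [sliceSite_apply_zero]
  rfl

omit [NeZero N] in
/-- The slice blocks `a_t, b_t` see only the spatial links of the slice `t`. [folklore] -/
theorem apDiag_apOff_congr {U V : GaugeConfig 4 (h + 1 + (h + 1)) 𝕊𝕌} {t : Fin (h + 1 + (h + 1))}
    (hUV : ∀ (y : Fin 3 → ZMod (h + 1 + (h + 1))) (j : Fin 3), U (sliceSite t y, j.succ) = V (sliceSite t y, j.succ))
    (m : ℝ) : apDiag U m t = apDiag V m t ∧ apOff U t = apOff V t := by
  have h1 : ∀ j, sliceHop ρ₀ (apLift U) t j = sliceHop ρ₀ (apLift V) t j := fun j => by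
    ext p q; simp only [sliceHop, Matrix.of_apply, apLift_sliceSite_succ, unitaryLift_apply, hUV]
  have h2 : ∀ j, sliceHop' ρ₀ (apLift U) t j = sliceHop' ρ₀ (apLift V) t j := fun j => by
    ext p q; simp only [sliceHop', Matrix.of_apply, apLift_sliceSite_succ, unitaryLift_apply, hUV]
  constructor
  · simp only [apDiag, sliceDiag, h1, h2]
  · simp only [apOff, sliceOff, h1, h2]

omit [NeZero N] in
/-- The transfer step `𝒴_t` sees only the spatial links of the slice `t`. [folklore] -/
theorem apStep_congr {U V : GaugeConfig 4 (h + 1 + (h + 1)) 𝕊𝕌} {t : Fin (h + 1 + (h + 1))}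
    (hUV : ∀ (y : Fin 3 → ZMod (h + 1 + (h + 1))) (j : Fin 3), U (sliceSite t y, j.succ) = V (sliceSite t y, j.succ))
    (m : ℝ) : apStep U m t = apStep V m t := by
  obtain ⟨ha, hb⟩ := apDiag_apOff_congr hUV m
  rw [apStep, apStep, ha, hb]

omit [NeZero N] in
/-- The temporal block `w_t` sees only the temporal links of the layer `t`. [folklore] -/
theorem apLink_congr {U V : GaugeConfig 4 (h + 1 + (h + 1)) 𝕊𝕌} {t : Fin (h + 1 + (h + 1))}
    (hUV : ∀ y : Fin 3 → ZMod (h + 1 + (h + 1)), U (sliceSite t y, 0) = V (sliceSite t y, 0)) :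
    apLink U t = apLink V t := by
  ext ⟨⟨y, a⟩, k⟩ ⟨⟨y', b⟩, k'⟩
  simp only [apLink, sliceLink_apply, unitaryLift_apply, hUV]

omit [NeZero N] in
/-- **The fermionic coupling depends only on the spatial links inside the two reflection planes
`t = 0` and `t = T = L/2`.** [folklore] -/
theorem fermionCoupling_congr {U V : GaugeConfig 4 (h + 1 + (h + 1)) 𝕊𝕌}
    (hUV : ∀ e : Edge 4 (h + 1 + (h + 1)), e.2 ≠ 0 →
      ((e.1 0).val = 0 ∨ (e.1 0).val = (h + 1 + (h + 1)) / 2) → U e = V e) (m : ℝ) :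
    fermionCoupling U m = fermionCoupling V m := by
  have hv0 : ∀ y : Fin 3 → ZMod (h + 1 + (h + 1)), ((sliceSite (0 : Fin (h + 1 + (h + 1))) y) 0).val = 0 :=
    fun y => by rw [val_sliceSite_zero, Fin.val_zero]
  have hvT : ∀ y : Fin 3 → ZMod (h + 1 + (h + 1)),
      ((sliceSite ((Fin.natAdd (h + 1) (0 : Fin (h + 1)) : Fin (h + 1 + (h + 1)))) y) 0).val =
        (h + 1 + (h + 1)) / 2 := fun y => by
    rw [val_sliceSite_zero, Fin.val_natAdd, Fin.val_zero]; omega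
  have h0 : ∀ (y : Fin 3 → ZMod (h + 1 + (h + 1))) (j : Fin 3), U (sliceSite 0 y, j.succ) = V (sliceSite 0 y, j.succ) :=
    fun y j => hUV (sliceSite 0 y, j.succ) (Fin.succ_ne_zero j) (Or.inl (hv0 y))
  have hT : ∀ (y : Fin 3 → ZMod (h + 1 + (h + 1))) (j : Fin 3),
      U (sliceSite ((Fin.natAdd (h + 1) (0 : Fin (h + 1)) : Fin (h + 1 + (h + 1)))) y, j.succ) =
        V (sliceSite ((Fin.natAdd (h + 1) (0 : Fin (h + 1)) : Fin (h + 1 + (h + 1)))) y, j.succ) :=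
    fun y j => hUV (sliceSite ((Fin.natAdd (h + 1) (0 : Fin (h + 1)) : Fin (h + 1 + (h + 1)))) y, j.succ)
      (Fin.succ_ne_zero j) (Or.inr (hvT y))
  rw [fermionCoupling, fermionCoupling, (apDiag_apOff_congr h0 m).1, (apDiag_apOff_congr hT m).1,
    apStep_congr h0, apStep_congr hT]

omit [NeZero N] in
/-- **The fermionic feature depends only on the links with both endpoints in `0 ≤ t ≤ L/2` that
are not inside the plane `t = 0`** (the positive block `P₀` of `TorusSiteRP`). [folklore] -/
theorem fermionFeature_congr {U V : GaugeConfig 4 (h + 1 + (h + 1)) 𝕊𝕌}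
    (hUV : ∀ e : Edge 4 (h + 1 + (h + 1)), (e.1 0).val < (h + 1 + (h + 1)) / 2 →
      (e.2 = 0 ∨ 1 ≤ (e.1 0).val) → U e = V e) (m : ℝ) (q : GramIdx h N) :
    fermionFeature U m q = fermionFeature V m q := by
  have hvs : ∀ (s : Fin (h + 1)) (y : Fin 3 → ZMod (h + 1 + (h + 1))),
      ((sliceSite (Fin.castLE (Nat.le_add_right (h + 1) (h + 1)) s) y) 0).val = s.val := fun s y => by
    rw [val_sliceSite_zero, Fin.val_castLE]
  have hL : (h + 1 + (h + 1)) / 2 = h + 1 := by omega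
  have hsp : ∀ (s : Fin (h + 1)) (_ : (s : ℕ) ≠ 0) (y : Fin 3 → ZMod (h + 1 + (h + 1))) (j : Fin 3),
      U (sliceSite (Fin.castLE (Nat.le_add_right (h + 1) (h + 1)) s) y, j.succ) =
        V (sliceSite (Fin.castLE (Nat.le_add_right (h + 1) (h + 1)) s) y, j.succ) :=
    fun s hs y j => hUV (sliceSite (Fin.castLE (Nat.le_add_right (h + 1) (h + 1)) s) y, j.succ)
      (by rw [hvs, hL]; exact s.isLt) (Or.inr (by rw [hvs]; omega))
  have htm : ∀ (s : Fin (h + 1)) (y : Fin 3 → ZMod (h + 1 + (h + 1))),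
      U (sliceSite (Fin.castLE (Nat.le_add_right (h + 1) (h + 1)) s) y, 0) =
        V (sliceSite (Fin.castLE (Nat.le_add_right (h + 1) (h + 1)) s) y, 0) :=
    fun s y => hUV (sliceSite (Fin.castLE (Nat.le_add_right (h + 1) (h + 1)) s) y, 0)
      (by rw [hvs, hL]; exact s.isLt) (Or.inl rfl)
  have hc : posDiagDet U m = posDiagDet V m := by
    refine Finset.prod_congr rfl fun i _ => ?_
    have hi : (Fin.castAdd (h + 1) i.succ : Fin (h + 1 + (h + 1))) = Fin.castLE (Nat.le_add_right _ _) i.succ :=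
      Fin.ext (by simp)
    rw [hi, (apDiag_apOff_congr (hsp i.succ (by simp)) m).1]
  have hP : posTransfer U m = posTransfer V m := by
    unfold posTransfer halfTransfer
    have hfun : (fun s : Fin (h + 1) => (linkBlock (apLink U (Fin.castLE (Nat.le_add_right (h + 1) (h + 1)) s)))ᴴ *
        (if (s : ℕ) = 0 then 1 else apStep U m (Fin.castLE (Nat.le_add_right (h + 1) (h + 1)) s))) =
        (fun s : Fin (h + 1) => (linkBlock (apLink V (Fin.castLE (Nat.le_add_right (h + 1) (h + 1)) s)))ᴴ *
        (if (s : ℕ) = 0 then 1 else apStep V m (Fin.castLE (Nat.le_add_right (h + 1) (h + 1)) s))) := by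
      funext s
      rw [apLink_congr (htm s)]
      by_cases hs : (s : ℕ) = 0
      · rw [if_pos hs, if_pos hs]
      · rw [if_neg hs, if_neg hs, apStep_congr (hsp s hs)]
    rw [hfun]
  rw [fermionFeature, fermionFeature, hc, hP]

end FermionGramRegularity

end Literature.MathematicalPhysics.QuantumLattice

end
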